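import Literature.NumberTheory.EllipticCurves.CyclotomicZpExtensionLayerProofs
import HarnessLib

/-!
# The cyclotomic `ℤ₂`-extension of `ℚ`: the `n`-th layer `ℚ_n = ℚ(ζ_{2^{n+2}})⁺` lies inside
# `ℚ(μ_{2^{n+2}})`, i.e. `Gal(ℚ̄/ℚ(μ_{2^{n+2}})) ≤ Gal(ℚ̄/ℚ_n)` — the `p = 2` case left as
# `TODO(general form)` in `CyclotomicZpExtensionLayerProofs.lean` (proofs only; no definitions, no named facts)

Topic `NumberTheory/EllipticCurves` (next to `CyclotomicZpExtensionLayerProofs.lean`). Seat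
`bsd-2adic-ord-2` (prover, cell `bsd-2adic`, item stmt-BirchSwinnertonDyer-19573): on the TOWER road at
`p = 2` the layer fields are `ℚ_1 = ℚ(√2)`, `ℚ_2 = ℚ(ζ₁₆)⁺`, `ℚ_3 = ℚ(ζ₃₂)⁺`; a rational prime
`ℓ ≡ 1 (mod 2^{n+2})` has its decomposition group inside `Gal(ℚ̄/ℚ(μ_{2^{n+2}}))`, hence — by this
file — inside the layer subgroup `Gal(ℚ̄/ℚ_n)`, which is what a layer-`n` torsion certificate
`#E[2^∞]^{Gal(ℚ̄/ℚ_n)} ≤ #Ẽ(𝔽_ℓ)(2)` needs.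

## Statements

* `CyclotomicZp.pow_dvd_ell_of_norm_sub_one_le_two` — for a unit `u ≡ 1 (mod 2^{n+2})` of `ℤ₂`,
  `2^n ∣ ℓ(u)` for the normalised logarithm `ℓ` of `CyclotomicZpExtension.lean` (`γ_cyc = 5`,
  `γ_cyc^{2ℓ(u)} = u²`): from `‖5^y − 1‖ = ‖y‖·‖4‖` (`PadicOneUnits.norm_oneAddPow_sub_one` with
  `e + 1 = 2`, Serre, *Cours d'arithmétique* II.3.2) and `‖u² − 1‖ = ‖u − 1‖·‖u + 1‖ ≤ ‖2^{n+2}‖·‖2‖`.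
* `CyclotomicZp.rootsOfUnityFixer_le_layerSubgroup_zpExtension_two` —
  `rootsOfUnityFixer ℚ (2^(n+2)) ≤ (zpExtension 2).layerSubgroup n`: an automorphism fixing a
  primitive `2^{n+2}`-th root of unity has `χ₂(σ) ≡ 1 (mod 2^{n+2})`, hence `κ_cyc(σ) = ℓ(χ₂ σ) ∈ 2^n ℤ₂`.
* `ZpExtension.IsCyclotomic.rootsOfUnityFixer_le_layerSubgroup_two` — the same for EVERY cyclotomic
  `κ : ZpExtension ℚ 2` (`κ` is a unit twist of `κ_cyc`; unit twists do not move the layers).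
* `ZpExtension.IsCyclotomic.cyclotomicLevelsRat_level_le_layerSubgroup_two` — the Euler-system
  phrasing: `(cyclotomicLevelsRat 2 S).level (n+2) ∅ ≤ κ.layerSubgroup n`.

The shift is `2` instead of `1` because `μ(ℤ₂) = {±1}` has order `2 = #(ℤ/4)ˣ`: `ℚ_∞ ⊂ ℚ(μ_{2^∞})` is
the fixed field of `{±1}`, and `ℚ_n ⊂ ℚ(μ_{2^{n+2}})` (Washington §13.1; e.g. `ℚ_1 = ℚ(√2) ⊂ ℚ(μ₈)`).

References: L. C. Washington, *Introduction to Cyclotomic Fields*, 2nd ed. (1997), §13.1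
[Washington1997]; J.-P. Serre, *A Course in Arithmetic*, Ch. II §3.2 Prop. 8 (`ℤ₂ˣ = {±1} × (1 + 4ℤ₂)`,
`1 + 4ℤ₂ = 5^{ℤ₂}`) [Serre1973]; tree: `CyclotomicZpExtension.lean` (`ell`, `cycPow`, `zpExtension`,
`norm_sub_one_le_of_toZModPow_eq_one`), `CyclotomicZpExtensionLayerProofs.lean` (the odd-`p` twin),
`ZpExtensionUnitTwistProofs.lean`, `CyclotomicLevels.lean` (`rootsOfUnityFixer`).
-/

noncomputable section

open scoped NumberField
open Field
open Literature.NumberTheory.GaloisRepresentations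
open Literature.NumberTheory.EllipticCurves Literature.NumberTheory.EllipticCurves.PadicOneUnits

namespace Literature.NumberTheory.EllipticCurves.CyclotomicZp

/-- At `p = 2` the cyclotomic exponent is `2` (`γ_cyc = 1 + 2² = 5`). [folklore] -/
private theorem cyclotomicExponent_two : cyclotomicExponent 2 = 2 := by
  unfold cyclotomicExponent; simp

/-- At `p = 2` the torsion order `#μ(ℤ₂)` is `2`. [folklore] -/
private theorem torsionOrder_two : torsionOrder 2 = 2 := by
  rw [torsionOrder, cyclotomicExponent_two]; decide

/-- **`2^n ∣ ℓ(u)` for `u ≡ 1 (mod 2^{n+2})`.** With `γ_cyc = 5` and `γ_cyc^{2ℓ(u)} = u²`: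
`‖5^y − 1‖ = ‖y‖·‖4‖` (Serre, *Cours d'arithmétique* II.3.2) and
`‖u² − 1‖ = ‖u − 1‖·‖u + 1‖ ≤ ‖2^{n+2}‖·‖2‖` give `‖2ℓ(u)‖ ≤ ‖2^{n+1}‖` — i.e.
`log₂(1 + 2^{n+2}ℤ₂) = 2^{n+2}ℤ₂ = 2^n · log₂(5)ℤ₂`. [cite: Serre1973, Ch. II §3.2 Prop. 8] -/
theorem pow_dvd_ell_of_norm_sub_one_le_two (u : ℤ_[2]ˣ) (n : ℕ)
    (hu : ‖(u : ℤ_[2]) - 1‖ ≤ ‖(2 : ℤ_[2]) ^ (n + 2)‖) : (2 : ℤ_[2]) ^ n ∣ ell 2 u := by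
  set y : ℤ_[2] := torsionOrder 2 * ell 2 u with hy
  -- `γ_cyc^y = u²`
  have h1 : cycPow 2 y = (u : ℤ_[2]) ^ torsionOrder 2 := cycPow_torsionOrder_mul_ell 2 u
  -- `‖γ_cyc^y − 1‖ = ‖y‖ · ‖4‖`
  have h2 : ‖cycPow 2 y - 1‖ = ‖y‖ * ‖((2 : ℕ) : ℤ_[2]) ^ (cyclotomicExponent 2 - 1 + 1)‖ :=
    norm_oneAddPow_sub_one (p := 2) (cyclotomicExponent 2 - 1) (cyclotomicExponent_cond 2) y
  rw [cyclotomicExponent_two, show (2 - 1 + 1 : ℕ) = 2 from rfl, Nat.cast_ofNat] at h2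
  -- `‖u + 1‖ ≤ ‖2‖` (`u + 1 = (u − 1) + 2`, `‖u − 1‖ ≤ ‖2^{n+2}‖ ≤ ‖2‖`)
  have h2le : ‖(2 : ℤ_[2]) ^ (n + 2)‖ ≤ ‖(2 : ℤ_[2])‖ := norm_le_of_dvd (dvd_pow_self _ (by omega))
  have hplus : ‖(u : ℤ_[2]) + 1‖ ≤ ‖(2 : ℤ_[2])‖ := by
    rw [show (u : ℤ_[2]) + 1 = ((u : ℤ_[2]) - 1) + 2 by ring]
    exact (PadicInt.nonarchimedean _ _).trans (max_le (hu.trans h2le) le_rfl)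
  -- `‖u² − 1‖ ≤ ‖2^{n+2}‖ · ‖2‖ = ‖2^{n+1}‖ · ‖4‖`
  have h22 : ‖(2 : ℤ_[2]) ^ (n + 1)‖ * ‖(2 : ℤ_[2]) ^ 2‖ = ‖(2 : ℤ_[2]) ^ (n + 2)‖ * ‖(2 : ℤ_[2])‖ := by
    rw [← norm_mul, ← norm_mul]; congr 1; ring
  have h3 : ‖(u : ℤ_[2]) ^ torsionOrder 2 - 1‖ ≤ ‖(2 : ℤ_[2]) ^ (n + 1)‖ * ‖(2 : ℤ_[2]) ^ 2‖ := by
    rw [torsionOrder_two, show (u : ℤ_[2]) ^ 2 - 1 = ((u : ℤ_[2]) - 1) * ((u : ℤ_[2]) + 1) by ring,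
      norm_mul, h22]
    exact mul_le_mul hu hplus (norm_nonneg _) (norm_nonneg _)
  -- so `‖y‖ · ‖4‖ ≤ ‖2^{n+1}‖ · ‖4‖`, i.e. `‖y‖ ≤ ‖2^{n+1}‖`
  have h20 : (2 : ℤ_[2]) ≠ 0 := two_ne_zero
  have hp0 : (0 : ℝ) < ‖(2 : ℤ_[2]) ^ 2‖ := norm_pos_iff.mpr (pow_ne_zero _ h20)
  have h4 : ‖y‖ * ‖(2 : ℤ_[2]) ^ 2‖ ≤ ‖(2 : ℤ_[2]) ^ (n + 1)‖ * ‖(2 : ℤ_[2]) ^ 2‖ := by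
    rw [← h2, h1]; exact h3
  have h5 : ‖y‖ ≤ ‖(2 : ℤ_[2]) ^ (n + 1)‖ := le_of_mul_le_mul_right h4 hp0
  have h6 : (2 : ℤ_[2]) ^ (n + 1) ∣ y :=
    dvd_of_norm_le (pow_ne_zero _ h20) h5
  -- remove the factor `t = 2`: `2^{n+1} ∣ 2·ℓ(u)` gives `2^n ∣ ℓ(u)`
  rw [hy, torsionOrder_two, Nat.cast_ofNat, pow_succ, mul_comm ((2 : ℤ_[2]) ^ n)] at h6
  exact (mul_dvd_mul_iff_left h20).mp h6

/-- **`Gal(ℚ̄/ℚ(μ_{2^{n+2}})) ≤ Gal(ℚ̄/ℚ_n)` for the normalised cyclotomic `ℤ₂`-extension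
`κ_cyc = ℓ ∘ χ₂` of `ℚ`**: an automorphism fixing the `2^{n+2}`-th roots of unity has
`χ₂(σ) ≡ 1 (mod 2^{n+2})`, hence `κ_cyc(σ) = ℓ(χ₂ σ) ∈ 2^n ℤ₂`. (Washington, *Introduction to
Cyclotomic Fields* §13.1: `ℚ_n ⊂ ℚ(ζ_{2^{n+2}})` is the fixed field of `{±1} = (ℤ/4)ˣ`.)
[cite: Washington1997, §13.1] -/
theorem rootsOfUnityFixer_le_layerSubgroup_zpExtension_two (n : ℕ) :
    rootsOfUnityFixer ℚ (2 ^ (n + 2)) ≤ (zpExtension 2).layerSubgroup n := by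
  intro σ hσ
  rw [ZpExtension.mem_layerSubgroup, zpExtension_apply, toAdd_ofAdd]
  refine pow_dvd_ell_of_norm_sub_one_le_two _ n ?_
  have h := norm_sub_one_le_of_toZModPow_eq_one 2 (n := n + 2)
    (u := ((GaloisRep.cyclotomicCharacter ℚ 2 σ : ℤ_[2]ˣ) : ℤ_[2])) ?_
  · simpa using h
  -- `χ₂(σ) ≡ 1 (mod 2^{n+2})` from `σ ζ = ζ` for a primitive `2^{n+2}`-th root of unity `ζ`
  haveI : NeZero (2 ^ (n + 2)) := ⟨pow_ne_zero _ two_ne_zero⟩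
  obtain ⟨ζ, hζ⟩ := HasEnoughRootsOfUnity.exists_primitiveRoot (AlgebraicClosure ℚ) (2 ^ (n + 2))
  have hfix : σ • ζ = ζ := hσ ζ hζ.pow_eq_one
  have hspec := GaloisRep.cyclotomicCharacter_spec ℚ 2 (k := n + 2) σ ζ hζ.pow_eq_one
  rw [hfix] at hspec
  -- `ζ^1 = ζ^v` with `v = (χ₂ σ mod 2^{n+2}).val < 2^{n+2}`, so `v = 1`
  set x := (GaloisRep.cyclotomicCharacter ℚ 2 σ).val.toZModPow (n + 2) with hx
  have hlt : 1 < 2 ^ (n + 2) := Nat.one_lt_pow (Nat.succ_ne_zero _) one_lt_two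
  have hv1 : 1 = x.val := by
    refine hζ.pow_inj hlt (ZMod.val_lt _) ?_
    rw [pow_one]
    exact hspec
  haveI : Fact (1 < 2 ^ (n + 2)) := ⟨hlt⟩
  apply ZMod.val_injective
  rw [ZMod.val_one, ← hv1]

end Literature.NumberTheory.EllipticCurves.CyclotomicZp

namespace Literature.NumberTheory.EllipticCurves.ZpExtension

/-- **`Gal(ℚ̄/ℚ(μ_{2^{n+2}})) ≤ Gal(ℚ̄/ℚ_n)` for EVERY cyclotomic `ℤ₂`-extension `κ` of `ℚ`** (`κ` is a
unit twist of `κ_cyc`, and unit twists do not move the layers): `ℚ_n`, the unique subfield of `ℚ_∞` of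
degree `2^n`, lies in `ℚ(ζ_{2^{n+2}})` (`ℚ_1 = ℚ(√2) ⊂ ℚ(ζ₈)`, `ℚ_2 = ℚ(ζ₁₆)⁺`, `ℚ_3 = ℚ(ζ₃₂)⁺`).
[cite: Washington1997, §13.1] -/
theorem IsCyclotomic.rootsOfUnityFixer_le_layerSubgroup_two {κ : ZpExtension ℚ 2}
    (hκ : κ.IsCyclotomic) (n : ℕ) :
    rootsOfUnityFixer ℚ (2 ^ (n + 2)) ≤ κ.layerSubgroup n := by
  obtain ⟨u, rfl⟩ := IsCyclotomic.exists_eq_unitTwist_holds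
    (CyclotomicZp.isCyclotomic_zpExtension 2) hκ
  rw [layerSubgroup_unitTwist]
  exact CyclotomicZp.rootsOfUnityFixer_le_layerSubgroup_zpExtension_two n

/-- The same inclusion in the language of the tree's Euler-system levels at `p = 2`: the level
`(cyclotomicLevelsRat 2 S).level (n+2) ∅ = Gal(ℚ̄/ℚ(μ_{2^{n+2}}))` is contained in the layer subgroup
`Gal(ℚ̄/ℚ_n)` of every cyclotomic `κ`. [cite: Washington1997, §13.1] -/
theorem IsCyclotomic.cyclotomicLevelsRat_level_le_layerSubgroup_two {κ : ZpExtension ℚ 2}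
    (hκ : κ.IsCyclotomic) (S : Set (IsDedekindDomain.HeightOneSpectrum (𝓞 ℚ))) (n : ℕ) :
    (cyclotomicLevelsRat 2 S).level (n + 2) ∅ ≤ κ.layerSubgroup n :=
  le_trans (by rw [cyclotomicLevelsRat_level]; exact inf_le_left)
    (hκ.rootsOfUnityFixer_le_layerSubgroup_two n)

end Literature.NumberTheory.EllipticCurves.ZpExtension

end
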